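import Literature.NumberTheory.EllipticCurves.PAdicMeasureTransformBranches
import Literature.NumberTheory.EllipticCurves.PAdicLFunctionMinusIntegralityProofs
import Literature.NumberTheory.EllipticCurves.PAdicLFunctionIntegralityAtTwoProofs
import HarnessLib

/-!
# The odd branches of the `2`-adic `L`-function are `2`-integral: `L₂⁻(f, α, ω, T) ∈ ℤ₂⟦T⟧`
# for `4 ∤ N`, with NO Eisenstein / irreducibility hypothesis (proofs only)

A *proofs* file (theorems only; no definition, no named fact; D-0014/D-0026), the MINUS companion of
`PAdicLFunctionIntegralityAtTwoProofs` (`padicLFunction_integral_two`: the EVEN branch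
`L₂(f, α, T) ∈ ℤ₂⟦T⟧` for `E[2]` irreducible, via an odd Eisenstein multiple). For the ODD branches
(`padicLFunctionMinusBranch f α i`, `i` odd — at `p = 2` the Teichmüller character `ω = χ₋₄` has
order `2`, so there is one odd branch, `i = 1`; and `padicLFunctionMinusBranchMult` at `2 ∥ N`) the
Eisenstein input disappears, because the minus symbol has no `L(f,1)`-offset:

1. `2·[a/2ⁿ]⁻_f ∈ ℤ` for `4 ∤ N`, so `‖μ⁻_{f,α}(a + 2ᵐℤ₂)‖ ≤ 2` for `‖α⁻¹‖ ≤ 1`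
   (`norm_msdMinusMeasure_two_le_two`, file `PAdicLFunctionMinusIntegralityProofs`; here also the
   one-term measure at `2 ∥ N`, `norm_msdMinusMeasureMult_two_le_two`);
2. (`finsum_weighted_two_of_odd`) **the `Δ = {±1}`-doubling for ODD families**: at `p = 2` the torsion
   of `ℤ₂^×` is `{±1}` and for an odd family (`μ(−a) = −μ(a)`: `msdMinusMeasure_neg`,
   `msdMinusMeasureMult_neg`) and odd `i` the `ζ = −1` half of the weighted Riemann sum
   `∑_ζ ζ^i ∑_s μ(ζ5ˢ + 2ⁿ⁺²ℤ₂) C(s,k)` equals the `ζ = 1` half (`(−1)·(−μ(5ˢ)) = μ(5ˢ)`), so the sum is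
   `2 · ∑_s μ(5ˢ + 2ⁿ⁺²ℤ₂) C(s,k)` — hence of norm `≤ ‖2‖₂ · 2 = 1`
   (`norm_padicLMinusBranchRiemannSum_two_le`);
3. the Riemann sums CONVERGE (`tendsto_padicLMinusBranchRiemannSum`, file
   `PAdicMeasureTransformBranches`: the `ω^i`-twisted family is again a bounded distribution), so the
   bound passes to the coefficients: **`‖[Tᵏ] L₂⁻(f, α, ω^i, T)‖ ≤ 1` for every `k`**
   (`norm_padicLMinusBranchCoeff_two_le_one`; discharged for a rational newform at a good ordinary `2`,
   `padicLFunctionMinusBranch_integral_two`, and at a multiplicative `2`,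
   `padicLFunctionMinusBranchMult_integral_two`, from the tree's distribution relations
   `sum_fiber_msdMinusMeasure_succ_eq_of_coeffField`, `sum_fiber_msdMinusMeasureMult_succ_eq_of_coeffField`).

STATUS IN PRINT. Mazur–Tate–Teitelbaum 1986 §I.10–I.13 construct the branches for all `p` (at `p = 2`
with `Δ = {±1}`, `γ = 5`, §I.13); the integrality of the odd branch at `2` in THIS normalisation
(`Ω⁻_f` with `im Λ_f = ℤ·Ω⁻_f/2`, `Δ`-pushforward included) is a theorem of the tree's definitions,
not printed as such. Requested by the residual cell `b2b-bsdres` (class O1 = X5 at `p = 2`; o1 lens-1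
GEN 3, step S1 "`padicLFunctionMinusBranch_mem_integral_two : ¬ 4 ∣ N → padicLFunctionMinusBranch f α 1 ∈ Λ₂`",
`HOME/cells/o1/ROUTES-O1.md`; the F8 odd-branch slot `KatoDivisibilityAtTwoOddBranchUpTo` is worded
over this object). EVIDENCE before this proof (census, not used): `μ⁻ ≥ 0` on 1 229/1 229 curves,
odd-branch integrality 648/648 (kit job j123633).

## References

* B. Mazur, J. Tate, J. Teitelbaum, *On `p`-adic analogues of the conjectures of Birch and
  Swinnerton-Dyer*, Invent. Math. 84 (1986), §I.10 (10.1), §I.11–I.13 (at `p = 2`: `Δ = {±1}`,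
  `γ = 5`). [MazurTateTeitelbaum1986Invent]
* J. E. Cremona, *Algorithms for modular elliptic curves*, 2nd ed. (1997), §2.2 Lemma 2.2.3, §2.8.
  [CremonaAlgorithms1997]
-/

noncomputable section

open Filter Topology

open scoped MatrixGroups

open CongruenceSubgroup Literature.NumberTheory.EllipticCurves.ModularForms

namespace Literature.NumberTheory.EllipticCurves

/-! ### §1. The one-term minus measure at `2 ∥ N`: oddness and the bound `‖μ⁻‖₂ ≤ 2` -/

section MultMeasure

variable {N : ℕ} [NeZero N] (f : CuspForm (Gamma0 N) 2)

/-- **The one-term minus measure is odd**: `μ⁻_{f,α}(−a + pᵐℤ_p) = −μ⁻_{f,α}(a + pᵐℤ_p)` (`p ∣ N`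
version, any prime `p`): for `m = 0` both sides vanish (`msdMinusMeasureMult_zero`); for `a = 0`
both sides are `α⁻ᵐ[0]⁻ = 0`; otherwise the representative of `−a` is `p^m − a.val` and
`[(p^m − v)/p^m]⁻ = [−v/p^m + 1]⁻ = −[v/p^m]⁻` (`ratMinusSymbol_add_intCast`, `ratMinusSymbol_neg`).
Twin of `msdMinusMeasure_neg`. [cite: MazurTateTeitelbaum1986Invent, §I.10 (10.1) with ε(p) = 0] -/
theorem msdMinusMeasureMult_neg {p : ℕ} [Fact p.Prime] (α : ℚ_[p]) : ∀ (m : ℕ) (a : ZMod (p ^ m)),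
    msdMinusMeasureMult f α m (-a) = -msdMinusMeasureMult f α m a
  | 0, a => by rw [msdMinusMeasureMult_zero, msdMinusMeasureMult_zero, neg_zero]
  | m + 1, a => by
    have hp : p.Prime := Fact.out
    haveI : NeZero (p ^ (m + 1)) := ⟨pow_ne_zero _ hp.ne_zero⟩
    by_cases ha : a = 0
    · subst ha
      have h0 : msdMinusMeasureMult f α (m + 1) 0 = 0 := by
        simp only [msdMinusMeasureMult, ZMod.val_zero, Nat.cast_zero, zero_div, ratMinusSymbol_zero,
          Rat.cast_zero, mul_zero]
      rw [neg_zero, h0, neg_zero]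
    have hval : (-a).val = p ^ (m + 1) - a.val := by rw [ZMod.neg_val, if_neg ha]
    have hlt : a.val ≤ p ^ (m + 1) := (ZMod.val_lt a).le
    have hcast : (((-a).val : ℕ) : ℚ) = (p : ℚ) ^ (m + 1) - (a.val : ℚ) := by
      rw [hval, Nat.cast_sub hlt]; push_cast; ring
    have hp0 : (p : ℚ) ≠ 0 := by exact_mod_cast hp.ne_zero
    have h1 : ratMinusSymbol f ((((-a).val : ℕ) : ℚ) / (p : ℚ) ^ (m + 1)) =
        -ratMinusSymbol f (((a.val : ℕ) : ℚ) / (p : ℚ) ^ (m + 1)) := by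
      have e : (((-a).val : ℕ) : ℚ) / (p : ℚ) ^ (m + 1) =
          -(((a.val : ℕ) : ℚ) / (p : ℚ) ^ (m + 1)) + ((1 : ℤ) : ℚ) := by
        rw [hcast]; push_cast; field_simp; ring
      rw [e, ratMinusSymbol_add_intCast, ratMinusSymbol_neg]
    simp only [msdMinusMeasureMult, h1]
    push_cast
    ring

/-- **`‖μ⁻_{f,α}(a + 2ᵐℤ₂)‖ ≤ 2` for the one-term minus measure, `4 ∤ N`, `‖α⁻¹‖ ≤ 1`** (real
coefficients): `μ⁻(a + 2ᵐℤ₂) = α⁻ᵐ[a/2ᵐ]⁻` and `‖[a/2ᵐ]⁻‖₂ ≤ 2` (`norm_ratMinusSymbol_two_le_two`).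
[cite: MazurTateTeitelbaum1986Invent, §I.10 (10.1) with ε(p) = 0] -/
theorem norm_msdMinusMeasureMult_two_le_two (hreal : ∀ n, (cuspCoeff f n).im = 0) (h4 : ¬ 4 ∣ N)
    {α : ℚ_[2]} (hα : ‖α⁻¹‖ ≤ 1) (m : ℕ) (a : ZMod (2 ^ m)) :
    ‖msdMinusMeasureMult f α m a‖ ≤ 2 := by
  have hden : ((((a.val : ℕ) : ℚ)) / ((2 : ℕ) : ℚ) ^ m).den ∣ 2 ^ m := by
    have h := Rat.den_dvd (a.val : ℤ) ((2 : ℤ) ^ m)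
    rw [Rat.divInt_eq_div] at h
    push_cast at h
    exact_mod_cast h
  unfold msdMinusMeasureMult
  rw [norm_mul, norm_pow]
  have h1 : ‖α⁻¹‖ ^ m ≤ 1 := pow_le_one₀ (norm_nonneg _) hα
  have h2 := norm_ratMinusSymbol_two_le_two f hreal h4 hden
  calc _ ≤ 1 * 2 := mul_le_mul h1 h2 (norm_nonneg _) zero_le_one
    _ = 2 := one_mul _

end MultMeasure

/-! ### §2. The `Δ = {±1}`-doubling of the odd-branch Riemann sums at `p = 2` -/

section Doubling

/-- The `2`-adic roots of unity of order dividing `2` are `±1` (private helper).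
[folklore] -/
private theorem coe_rootsOfUnity_two_eq_one_or (ξ : rootsOfUnity 2 ℤ_[2]) :
    ((ξ : ℤ_[2]ˣ) : ℤ_[2]) = 1 ∨ ((ξ : ℤ_[2]ˣ) : ℤ_[2]) = -1 := by
  have h := ξ.2
  rw [mem_rootsOfUnity] at h
  have h' : (((ξ : ℤ_[2]ˣ) : ℤ_[2])) ^ 2 = 1 := by
    rw [← Units.val_pow_eq_pow_val, h, Units.val_one]
  exact sq_eq_one_iff.mp h'

/-- **The `Δ = {±1}`-doubling for an ODD family at `p = 2`**: if `μ(−a + 2ᵐℤ₂) = −μ(a + 2ᵐℤ₂)` and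
`i` is odd, then `∑_ζ ζ^i ∑_{s mod 2ⁿ} μ(ζ5ˢ + 2ⁿ⁺²ℤ₂) C(s,k) = 2 · ∑_s μ(5ˢ + 2ⁿ⁺²ℤ₂) C(s,k)`
(the torsion of `ℤ₂^×` is `{±1}`, `torsionOrder_two`; the `ζ = −1` half is `(−1)^i μ(−5ˢ) = μ(5ˢ)`).
Odd twin of `padicLRiemannSum_two`. [cite: MazurTateTeitelbaum1986Invent, §I.13 (p = 2: Δ = {±1}, γ = 5)] -/
theorem finsum_weighted_two_of_odd {μ : (n : ℕ) → ZMod (2 ^ n) → ℚ_[2]}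
    (hodd : ∀ (n : ℕ) (a : ZMod (2 ^ n)), μ n (-a) = -μ n a) {i : ℕ} (hi : Odd i) (k n : ℕ) :
    ∑ᶠ ζ : rootsOfUnity (torsionOrder 2) ℤ_[2], ∑ s : ZMod (2 ^ n),
        ((((ζ : ℤ_[2]ˣ) : ℤ_[2]) : ℚ_[2]) ^ i *
          μ (n + cyclotomicExponent 2)
            (PadicInt.toZModPow (n + cyclotomicExponent 2) ((ζ : ℤ_[2]ˣ) : ℤ_[2]) *
              (cyclotomicGenerator 2 : ZMod (2 ^ (n + cyclotomicExponent 2))) ^ s.val) *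
          ((s.val.choose k : ℕ) : ℚ_[2])) =
      2 * ∑ s : ZMod (2 ^ n), μ (n + 2) ((cyclotomicGenerator 2 : ZMod (2 ^ (n + 2))) ^ s.val) *
        ((s.val.choose k : ℕ) : ℚ_[2]) := by
  classical
  set G : ℤ_[2] → ℚ_[2] := fun u ↦ ∑ s : ZMod (2 ^ n),
    ((u : ℚ_[2])) ^ i * μ (n + 2) (PadicInt.toZModPow (n + 2) u *
        (cyclotomicGenerator 2 : ZMod (2 ^ (n + 2))) ^ s.val) * ((s.val.choose k : ℕ) : ℚ_[2])
    with hG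
  have hG1 : G 1 = ∑ s : ZMod (2 ^ n),
      μ (n + 2) ((cyclotomicGenerator 2 : ZMod (2 ^ (n + 2))) ^ s.val) *
        ((s.val.choose k : ℕ) : ℚ_[2]) := by
    simp only [hG, map_one, one_mul, PadicInt.coe_one, one_pow]
  have hGneg : G (-1) = G 1 := by
    rw [hG1]
    simp only [hG, map_neg, map_one, neg_one_mul, hodd, PadicInt.coe_neg, PadicInt.coe_one,
      hi.neg_one_pow]
    refine Finset.sum_congr rfl fun s _ ↦ ?_
    ring
  -- the torsion group at `2` is `{1, ζ}` with `ζ = -1`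
  have hζmem : (-1 : ℤ_[2]ˣ) ∈ rootsOfUnity 2 ℤ_[2] := by
    rw [mem_rootsOfUnity]; norm_num
  set ζ : rootsOfUnity 2 ℤ_[2] := ⟨-1, hζmem⟩ with hζ
  have hne : (1 : rootsOfUnity 2 ℤ_[2]) ≠ ζ := by
    intro h
    have h' : (((1 : rootsOfUnity 2 ℤ_[2]) : ℤ_[2]ˣ) : ℤ_[2]) = ((ζ : ℤ_[2]ˣ) : ℤ_[2]) := by
      rw [h]
    rw [hζ] at h'
    simp only [OneMemClass.coe_one, Units.val_one, Units.val_neg] at h'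
    have h2 : (2 : ℤ_[2]) = 0 := by linear_combination h'
    exact two_ne_zero h2
  haveI : Fintype (rootsOfUnity 2 ℤ_[2]) := Fintype.ofFinite _
  have huniv : (Finset.univ : Finset (rootsOfUnity 2 ℤ_[2])) = {1, ζ} := by
    ext ξ
    simp only [Finset.mem_univ, Finset.mem_insert, Finset.mem_singleton, true_iff]
    rcases coe_rootsOfUnity_two_eq_one_or ξ with h | h
    · left
      exact Subtype.ext (Units.ext (by simpa using h))
    · right
      exact Subtype.ext (Units.ext (by rw [hζ]; simpa using h))
  have hL : (∑ᶠ ξ : rootsOfUnity (torsionOrder 2) ℤ_[2], ∑ s : ZMod (2 ^ n),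
        ((((ξ : ℤ_[2]ˣ) : ℤ_[2]) : ℚ_[2]) ^ i *
          μ (n + cyclotomicExponent 2)
            (PadicInt.toZModPow (n + cyclotomicExponent 2) ((ξ : ℤ_[2]ˣ) : ℤ_[2]) *
              (cyclotomicGenerator 2 : ZMod (2 ^ (n + cyclotomicExponent 2))) ^ s.val) *
          ((s.val.choose k : ℕ) : ℚ_[2]))) =
      ∑ᶠ ξ : rootsOfUnity (torsionOrder 2) ℤ_[2], G ((ξ : ℤ_[2]ˣ) : ℤ_[2]) := rfl
  rw [hL, torsionOrder_two, finsum_eq_sum_of_fintype, huniv, Finset.sum_pair hne]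
  simp only [OneMemClass.coe_one, Units.val_one, hζ, Units.val_neg]
  rw [hGneg, hG1, two_mul]

end Doubling

/-! ### §3. The odd branches at `2`: Riemann sums and coefficients of norm `≤ 1` -/

section OddBranch

variable {N : ℕ} [NeZero N] (f : CuspForm (Gamma0 N) 2) (α : ℚ_[2])

/-- **`‖RS⁻(k, n)‖ ≤ ‖2‖₂ · C`**: every Riemann sum of an odd branch of the minus measure at `2` has
norm `≤ 2⁻¹ · C` if `‖μ⁻_{f,α}‖ ≤ C` (doubling `finsum_weighted_two_of_odd` with `msdMinusMeasure_neg`,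
ultrametric inequality, `‖C(s,k)‖ ≤ 1`). [cite: MazurTateTeitelbaum1986Invent, §I.13 (p = 2)] -/
theorem norm_padicLMinusBranchRiemannSum_two_le {C : ℝ}
    (hC : ∀ (m : ℕ) (a : ZMod (2 ^ m)), ‖msdMinusMeasure f α m a‖ ≤ C) {i : ℕ} (hi : Odd i)
    (k n : ℕ) : ‖padicLMinusBranchRiemannSum f α i k n‖ ≤ 2⁻¹ * C := by
  classical
  have hC0 : 0 ≤ C := (norm_nonneg _).trans (hC 0 0)
  have h := finsum_weighted_two_of_odd (μ := msdMinusMeasure f α) (msdMinusMeasure_neg f α) hi k n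
  unfold padicLMinusBranchRiemannSum
  rw [h, norm_mul]
  have h2 : ‖(2 : ℚ_[2])‖ = (2 : ℝ)⁻¹ := by
    have h := Padic.norm_p (p := 2)
    simpa using h
  rw [h2]
  refine mul_le_mul_of_nonneg_left ?_ (by norm_num)
  refine IsUltrametricDist.norm_sum_le_of_forall_le_of_nonneg hC0 fun s _ ↦ ?_
  have hk := Padic.norm_int_le_one (p := 2) ((s.val.choose k : ℕ) : ℤ)
  rw [Int.cast_natCast] at hk
  rw [norm_mul]
  calc _ ≤ C * 1 := mul_le_mul (hC _ _) hk (norm_nonneg _) hC0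
    _ = C := mul_one C

/-- The same for the one-term minus measure at `2 ∥ N` (`msdMinusMeasureMult_neg`).
[cite: MazurTateTeitelbaum1986Invent, §I.13 (p = 2)] -/
theorem norm_padicLMinusBranchMultRiemannSum_two_le {C : ℝ}
    (hC : ∀ (m : ℕ) (a : ZMod (2 ^ m)), ‖msdMinusMeasureMult f α m a‖ ≤ C) {i : ℕ} (hi : Odd i)
    (k n : ℕ) : ‖padicLMinusBranchMultRiemannSum f α i k n‖ ≤ 2⁻¹ * C := by
  classical
  have hC0 : 0 ≤ C := (norm_nonneg _).trans (hC 0 0)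
  have h := finsum_weighted_two_of_odd (μ := msdMinusMeasureMult f α) (msdMinusMeasureMult_neg f α)
    hi k n
  unfold padicLMinusBranchMultRiemannSum
  rw [h, norm_mul]
  have h2 : ‖(2 : ℚ_[2])‖ = (2 : ℝ)⁻¹ := by
    have h := Padic.norm_p (p := 2)
    simpa using h
  rw [h2]
  refine mul_le_mul_of_nonneg_left ?_ (by norm_num)
  refine IsUltrametricDist.norm_sum_le_of_forall_le_of_nonneg hC0 fun s _ ↦ ?_
  have hk := Padic.norm_int_le_one (p := 2) ((s.val.choose k : ℕ) : ℤ)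
  rw [Int.cast_natCast] at hk
  rw [norm_mul]
  calc _ ≤ C * 1 := mul_le_mul (hC _ _) hk (norm_nonneg _) hC0
    _ = C := mul_one C

/-- **`‖[Tᵏ] L₂⁻(f, α, ω^i, T)‖ ≤ 1`, `i` odd, `4 ∤ N`, `‖α⁻¹‖ ≤ 1`, real coefficients**, granted the
distribution relation of `μ⁻_{f,α}` (`hdist`): the Riemann sums have norm `≤ 2⁻¹ · 2 = 1`
(`norm_padicLMinusBranchRiemannSum_two_le`, `norm_msdMinusMeasure_two_le_two`) and converge
(`norm_padicLMinusBranchCoeff_le_of_forall_le`). [cite: MazurTateTeitelbaum1986Invent, §I.12–I.13] -/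
theorem norm_padicLMinusBranchCoeff_two_le_one
    (hdist : ∀ (n : ℕ) (a : ZMod (2 ^ n)),
      ∑ b ∈ Finset.univ.filter (fun b : ZMod (2 ^ (n + 1)) ↦
        ZMod.castHom (pow_dvd_pow 2 n.le_succ) (ZMod (2 ^ n)) b = a), msdMinusMeasure f α (n + 1) b =
        msdMinusMeasure f α n a)
    (hreal : ∀ n, (cuspCoeff f n).im = 0) (h4 : ¬ 4 ∣ N) (hα : ‖α⁻¹‖ ≤ 1) {i : ℕ} (hi : Odd i)
    (k : ℕ) : ‖padicLMinusBranchCoeff f α i k‖ ≤ 1 := by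
  have hC := norm_msdMinusMeasure_two_le_two f hreal h4 hα
  refine norm_padicLMinusBranchCoeff_le_of_forall_le f α hdist hC i k fun n ↦ ?_
  have h := norm_padicLMinusBranchRiemannSum_two_le f α hC hi k n
  norm_num at h
  exact h

/-- The same for the one-term minus branch at `2 ∥ N`. [cite: MazurTateTeitelbaum1986Invent, §I.12–I.13] -/
theorem norm_padicLMinusBranchMultCoeff_two_le_one
    (hdist : ∀ (n : ℕ) (a : ZMod (2 ^ n)),
      ∑ b ∈ Finset.univ.filter (fun b : ZMod (2 ^ (n + 1)) ↦
        ZMod.castHom (pow_dvd_pow 2 n.le_succ) (ZMod (2 ^ n)) b = a),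
          msdMinusMeasureMult f α (n + 1) b = msdMinusMeasureMult f α n a)
    (hreal : ∀ n, (cuspCoeff f n).im = 0) (h4 : ¬ 4 ∣ N) (hα : ‖α⁻¹‖ ≤ 1) {i : ℕ} (hi : Odd i)
    (k : ℕ) : ‖padicLMinusBranchMultCoeff f α i k‖ ≤ 1 := by
  have hC := norm_msdMinusMeasureMult_two_le_two f hreal h4 hα
  refine norm_padicLMinusBranchMultCoeff_le_of_forall_le f α hdist hC i k fun n ↦ ?_
  have h := norm_padicLMinusBranchMultRiemannSum_two_le f α hC hi k n
  norm_num at h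
  exact h

end OddBranch

/-! ### §4. Discharge for rational newforms: good ordinary `2` and multiplicative `2` -/

section Newform

variable {N : ℕ} [NeZero N] {f : CuspForm (Gamma0 N) 2}

/-- **`L₂⁻(f, α, ω^i, T) ∈ ℤ₂⟦T⟧` for a rational newform of ODD level, `i` odd, and a root `α` of
`X² − a₂X + 2` with `‖α⁻¹‖ ≤ 1`** (the unit root at a good ORDINARY `2`, `a₂` odd): every coefficient
has norm `≤ 1`. UNCONDITIONAL: the distribution relation is the tree's
`sum_fiber_msdMinusMeasure_succ_eq_of_coeffField` (Manin–Drinfeld + MTT (4.2)), the bound is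
`2[a/2ⁿ]⁻ ∈ ℤ` (no hypothesis on `E[2]`). The o1 lens-1 statement S1
`padicLFunctionMinusBranch_mem_integral_two` (good case). [cite: MazurTateTeitelbaum1986Invent, §I.13] -/
theorem padicLFunctionMinusBranch_integral_two (hf : IsNewform0 f) (hQ : coeffField f = ⊥)
    (h2N : ¬ 2 ∣ N) {a₂ : ℤ} (ha₂ : cuspCoeff f 2 = a₂) {α : ℚ_[2]} (hα : ‖α⁻¹‖ ≤ 1)
    (hroot : α ^ 2 - a₂ * α + 2 = 0) {i : ℕ} (hi : Odd i) (k : ℕ) :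
    ‖PowerSeries.coeff k (padicLFunctionMinusBranch f α i)‖ ≤ 1 := by
  have hα₀ : α ≠ 0 := by
    rintro rfl
    norm_num at hroot
  have h4 : ¬ 4 ∣ N := fun h ↦ h2N (dvd_trans ⟨2, by norm_num⟩ h)
  rw [coeff_padicLFunctionMinusBranch]
  exact norm_padicLMinusBranchCoeff_two_le_one f α
    (sum_fiber_msdMinusMeasure_succ_eq_of_coeffField hf hQ h2N ha₂ hα₀ hroot)
    (cuspCoeff_im_eq_zero_of_coeffField_eq_bot hQ) h4 hα hi k

/-- **`L₂⁻(f, a₂, ω^i, T) ∈ ℤ₂⟦T⟧` for a rational newform with `2 ∥ N` (multiplicative `2`,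
`a₂ = ±1`), `i` odd**: every coefficient of the one-term odd branch has norm `≤ 1`. UNCONDITIONAL
(distribution relation `sum_fiber_msdMinusMeasureMult_succ_eq_of_coeffField`). The o1 lens-1 statement S1
(multiplicative case). [cite: MazurTateTeitelbaum1986Invent, §I.13] -/
theorem padicLFunctionMinusBranchMult_integral_two (hf : IsNewform0 f) (hQ : coeffField f = ⊥)
    (h2N : 2 ∣ N) (h4 : ¬ 4 ∣ N) {a₂ : ℤ} (ha₂ : cuspCoeff f 2 = a₂) (hunit : a₂ = 1 ∨ a₂ = -1)
    {i : ℕ} (hi : Odd i) (k : ℕ) :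
    ‖PowerSeries.coeff k (padicLFunctionMinusBranchMult f (a₂ : ℚ_[2]) i)‖ ≤ 1 := by
  have ha0 : ((a₂ : ℤ) : ℚ_[2]) ≠ 0 := by
    rcases hunit with rfl | rfl <;> norm_num
  have hα : ‖((a₂ : ℤ) : ℚ_[2])⁻¹‖ ≤ 1 := by
    rcases hunit with rfl | rfl <;> simp
  rw [coeff_padicLFunctionMinusBranchMult]
  exact norm_padicLMinusBranchMultCoeff_two_le_one f (a₂ : ℚ_[2])
    (sum_fiber_msdMinusMeasureMult_succ_eq_of_coeffField hf hQ h2N ha₂ ha0)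
    (cuspCoeff_im_eq_zero_of_coeffField_eq_bot hQ) h4 hα hi k

end Newform

/-! ### §5. For an elliptic curve `E = W/ℚ` good ordinary at `2`: `L₂⁻(E, ω^i, T) ∈ ℤ₂⟦T⟧` -/

section Curve

variable {N : ℕ} [NeZero N] {f : CuspForm (Gamma0 N) 2}
  {W : WeierstrassCurve ℚ} [W.IsElliptic] [W.IsGloballyMinimal]

/-- **`‖[Tᵏ] L₂⁻(f, α, ω^i, T)‖ ≤ 1` for the newform `f` of `E = W/ℚ` good ORDINARY at `2`, `α` the
unit root, `i` odd** — UNCONDITIONAL, no hypothesis on `E[2]` (contrast the even branch,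
`padicLFunction_integral_two`, which needs `E[2]` irreducible): `2 ∤ N`
(`not_dvd_level_of_isNewformOf`), `a₂(f) = a₂(E)` (`cuspCoeff_eq_frobeniusTrace_of_isNewformOf_holds`),
`α² − a₂α + 2 = 0`, `‖α‖ = 1` (`unitRoot_coe_spec`). [cite: MazurTateTeitelbaum1986Invent, §I.13] -/
theorem padicLFunctionMinusBranch_integral_two_of_isNewformOf (hord : IsOrdinaryAt W 2)
    (hf : IsNewformOf W f) {i : ℕ} (hi : Odd i) (k : ℕ) :
    ‖PowerSeries.coeff k (padicLFunctionMinusBranch f (unitRoot W 2 : ℚ_[2]) i)‖ ≤ 1 := by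
  obtain ⟨hαeq, hαu, -⟩ := unitRoot_coe_spec (W := W) hord
  have hpN : ¬ 2 ∣ N := not_dvd_level_of_isNewformOf hf hord.1
  have hap : cuspCoeff f 2 = ((W.frobeniusTrace 2 : ℤ) : ℂ) :=
    cuspCoeff_eq_frobeniusTrace_of_isNewformOf_holds hf hord.1
  have hα : ‖(unitRoot W 2 : ℚ_[2])⁻¹‖ ≤ 1 := by rw [norm_inv, hαu, inv_one]
  exact padicLFunctionMinusBranch_integral_two hf.1 hf.coeffField_eq_bot hpN hap hα hαeq hi k

/-- **`L₂⁻(E, ω^i, T) ∈ Λ = ℤ₂⟦T⟧`** (`i` odd) for `E = W/ℚ` globally minimal, good ordinary at `2`,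
`f` its newform: there is `G ∈ ℤ₂⟦T⟧` with `ι G = L₂⁻(f, α, ω^i, T)` (coefficientwise criterion
`exists_iwasawaToPowerSeries_eq_iff_norm_coeff_le_one`, MTT §I.12). The o1 lens-1 S1 statement
"`padicLFunctionMinusBranch f α 1 ∈ Λ₂`" for good ordinary `2`, with no `E[2]` hypothesis.
[cite: MazurTateTeitelbaum1986Invent, §I.12–I.13] -/
theorem exists_iwasawaToPowerSeries_eq_padicLFunctionMinusBranch_two (hord : IsOrdinaryAt W 2)
    (hf : IsNewformOf W f) {i : ℕ} (hi : Odd i) :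
    ∃ G : IwasawaAlgebra 2,
      iwasawaToPowerSeries 2 G = padicLFunctionMinusBranch f (unitRoot W 2 : ℚ_[2]) i :=
  (exists_iwasawaToPowerSeries_eq_iff_norm_coeff_le_one _).mpr fun k ↦
    padicLFunctionMinusBranch_integral_two_of_isNewformOf hord hf hi k

omit [W.IsElliptic] [W.IsGloballyMinimal] in
/-- **`L₂⁻(f, a₂, ω^i, T) ∈ Λ = ℤ₂⟦T⟧`** (`i` odd) for a rational newform with `2 ∥ N` and
`a₂ = ±1` (the newform of a curve with multiplicative reduction at `2`): coefficientwise criterion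
applied to `padicLFunctionMinusBranchMult_integral_two`. [cite: MazurTateTeitelbaum1986Invent, §I.12–I.13] -/
theorem exists_iwasawaToPowerSeries_eq_padicLFunctionMinusBranchMult_two (hf : IsNewform0 f)
    (hQ : coeffField f = ⊥) (h2N : 2 ∣ N) (h4 : ¬ 4 ∣ N) {a₂ : ℤ} (ha₂ : cuspCoeff f 2 = a₂)
    (hunit : a₂ = 1 ∨ a₂ = -1) {i : ℕ} (hi : Odd i) :
    ∃ G : IwasawaAlgebra 2,
      iwasawaToPowerSeries 2 G = padicLFunctionMinusBranchMult f (a₂ : ℚ_[2]) i :=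
  (exists_iwasawaToPowerSeries_eq_iff_norm_coeff_le_one _).mpr fun k ↦
    padicLFunctionMinusBranchMult_integral_two hf hQ h2N h4 ha₂ hunit hi k

end Curve

end Literature.NumberTheory.EllipticCurves

end
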